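import Summits.AtomisticToContinuum.Crystallization.Theorems.ChargedEnergyGapStressFreeFcc
import HarnessLib

/-!
(SPLIT FOR THE 400-LINE CAP by the landing lane, hand-2 g31: this file = part 1 of 3; sequels `…ChargedEnergyGapStabilityReductionB`, `…ChargedEnergyGapStabilityReduction` import it in a chain; same namespace, all FQNs unchanged.)
# `ChargedEnergyGap` — the ROTATION GAUGE, addendum P-K: HARMONIC STABILITY MODULO ROTATIONS of the stress-free fcc reference REDUCED TO ONE
# EXPLICIT LATTICE-SUM INEQUALITY (cell `decomp-a2c`, lens 3, generation 61, node «RotationGauge», part P-K = STAB-61 typed; over part P-J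
# `…Theorems.ChargedEnergyGapStressFreeFcc`)

WHAT THIS PART PROVES (every theorem PROVED; `Classical.choice` only through Mathlib).  After P-J the only unwitnessed hypothesis of the repaired
transfer piece (H𝄪ʳ) at the record dials is the single leaf `HarmStableModRot (1/100) (fccRef a₀)` (census ask STAB-61).  This part computes that
leaf down to a FINITE-DIMENSIONAL inequality between explicit lattice sums, with every structural step in the kernel:
  ★★★ `harmStableModRot_of_stabIneq : 0 < b → 9/50 ≤ b² → (∀ j k, S b j k = 0) → StabIneq μ₀ b → HarmStableModRot μ₀ (fccRef b)`,
  ★★★ `harmStableModRot_fcc_a0 : StabIneq μ₀ a₀ → HarmStableModRot μ₀ (fccRef a₀)` (the window `a₀² ≥ 9/50` and zero stress are P-J's),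
  ★★★ `exists_admissible_harmStableModRot_of : StabIneq (1/100) a₀ → ∃ P, IsSeparatedRef (3/5) P ∧ IsLabelledRef (1/3) 3 P ∧ IsForceFree P ∧
       IsStressFree P ∧ HarmStableModRot (1/100) P` — the COMPLETE hypothesis block of (H𝄪ʳ) at the record dials, modulo the one inequality
where ★ `StabIneq μ₀ b := ∀ M : 3×3 real matrices, μ₀ · Σ_{x ∈ nbhd b} ‖½(M + Mᵀ)(b·x)‖² ≤ ¼ · Σ'_{n ∈ D₃∖0} (14|b·n|⁻¹⁶ − 8|b·n|⁻¹⁰)·((b·n)ᵀ M (b·n))²`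
(`nbhd b` = the explicit finite neighbour set `{x ∈ [−4,4]³ ∩ D₃ ∖ 0 : b²|x|² ≤ 4}`, `Qsum`, `coef`, `qf`).  This is the rotation-gauged AFFINE
(elastic) stability of the Lennard-Jones fcc lattice in the Dirichlet currency — Bloch/phonon sectors do not occur: a ONE-POINT MOTIF HAS NO PERIODIC
TEST FIELDS, its global cocycles are exactly the homogeneous strains (§K1).

THE FOUR STEPS (and, §K6–§K8, the CONVERSE and the CUBIC REDUCTION — see EQUIVALENCES below).
 (K1) STRUCTURE ★ `exists_matrix`: a global cocycle `β` on the Bravais reference is translation-reduced (`cocycle_transl : β y z = β 0 (z − y)`,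
      periodicity with `g = y ∈ Λ`) and additive on the lattice (`cocycle_add`), hence an additive homomorphism `Λ →+ ℝ³` (`cocycleHom`); applying
      it to the lattice identity `2·(b·x) = Σⱼ xⱼ·(2b·eⱼ)` (`2b·eⱼ ∈ b·D₃`, `two_smul_vec`) gives `β(0, b·x) = M(b·x)` with `Mᵢⱼ = β(0, 2b·eⱼ)ᵢ/(2b)`.
 (K2) GAUGE ★ `exists_rot_gauge`: every skew matrix `(K₀₁, K₀₂, K₁₂) = (p, q, r)` is `v ⊗ r₀ − r₀ ⊗ v` — explicitly `r₀ = (q, r, 0)`,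
      `v = (pr, −pq, −(q²+r²))/(q²+r²)` if `(q, r) ≠ 0`, else `r₀ = e₁`, `v = p·e₀` (no continuous global section exists — hairy ball — hence the
      case split); `rotField_zero_apply : rotField r₀ v 0 z = (v ⊗ r₀ − r₀ ⊗ v) z`.  Gauging the skew part of `M` away EXACTLY leaves `E = ½(M + Mᵀ)`.
 (K3) THE QUADRATIC SITE TERM ★★ `quadSite_eq : quadSite β (fccRef b) ∅ 0 = ¼ · Qsum M b` at zero stress: `bondQuad` of a linear field at the
      bond `z = b·n` is `(V″ − V′/d)d⁻²·(zᵀMz)² + (V′/d)·‖Mz‖²` (`bondQuad_zero_eq`), `(V″ − V′/d)d⁻² = 14d⁻¹⁶ − 8d⁻¹⁰` (`stiff_eq`), and the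
      TRANSVERSE part sums to `Σᵢⱼₖ Mᵢⱼ Mᵢₖ S b j k = 0` — a linear combination of virial entries (summability from P-J's `summable_term`;
      `summable_coef_qf` by `|zᵀMz| ≤ (Σ|Mᵢⱼ|)·|z|²`).
 (K4) THE DIRICHLET TERM ★★ `dirichletSite_eq : dirichletSite β (fccRef b) 0 = Σ_{x ∈ nbhd b} ‖β(0, b·x)‖²` for `b² ≥ 9/50`: the summation
      domain `{z ∈ b·D₃ : z ≠ 0, |z| ≤ 2}` IS the image of the finite set `nbhd b` (`dirichlet_set_eq`; `|xₖ|² ≤ |x|² ≤ 4/b² < 25`), so the `tsum`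
      is a `Finset.sum` (`tsum_congr_set_coe`, `Finset.tsum_subtype'`, `Finset.sum_image`).
Assembly ★★★ `harmStableModRot_of_stabIneq`: unfold, gauge by (K2) with `(p, q, r)` the skew part of `M`, rewrite by (K3), (K4); the gauged field
at `b·x` has components `Σⱼ ½(Mᵢⱼ + Mⱼᵢ)(b·xⱼ)` (`fin_cases` on the nine entries), and the inequality IS `StabIneq μ₀ b` at `M`.

EQUIVALENCES (§K6–§K8, all PROVED).  ★★ `stabIneq_of_harmStableModRot` (CONVERSE, `μ₀ ≥ 0`): test the linear cocycle `β(y,z) = M(z − y)`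
(`isGlobalCocycle_linCocycle`); by CUBIC ISOTROPY of the neighbour set — ★ `sum_nbhd_quad : Σ_{x ∈ nbhd b} ⟨a, b·x⟩² = N₂(b)·|a|²` (sign flips
kill the mixed second moments `sum_nbhd_mul_eq_zero`, swaps equalise the pure ones `sum_nbhd_sq_eq`) — any gauge `W ∈ so(3)` only ADDS
`N₂·‖skew M − W‖²` to the Dirichlet side, so ★★★ `harmStableModRot_iff_stabIneq : HarmStableModRot μ₀ (fccRef b) ↔ StabIneq μ₀ b` (zero stress,
`b² ≥ 9/50`, `μ₀ ≥ 0`).  ★★ `Qsum_closed`: with the moment tensor `Tm b i j k l = Σ' coef·(b nᵢ)(b nⱼ)(b nₖ)(b nₗ)` (`Qsum_eq_Tm`), its SIGN-FLIP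
covariance `Tm_neg` (odd moments vanish, `Tm_eq_zero'`, discharged by `decide` over the 81 index patterns) and SWAP covariance `Tm_swap`
(`Tm_1111 = Tm_2222 = P₄ := Tm_0000`, `Tm_0022 = Tm_1122 = P₂₂ := Tm_0011`),
`Qsum M b = P₄·Σ Mᵢᵢ² + P₂₂·(2Σ_{i<k} MᵢᵢMₖₖ + Σ_{i<j}(Mᵢⱼ + Mⱼᵢ)²)`; hence ★★★ `stabIneq_of_scalars` / `scalars_of_stabIneq` /
`harmStableModRot_iff_scalars : HarmStableModRot μ₀ (fccRef b) ↔ (4μ₀N₂ ≤ P₄ − P₂₂ ∧ 4μ₀N₂ ≤ 2P₂₂)` (SOS certificate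
`4(RHS − LHS) = (P₄ − P₂₂ − λ)ΣMᵢᵢ² + P₂₂(ΣMᵢᵢ)² + (2P₂₂ − λ)Σ_{i<j}(Mᵢⱼ+Mⱼᵢ)²/2 + λ·Σ_{i<j}(Mᵢⱼ − Mⱼᵢ)²/2`, `λ = 4μ₀N₂`; necessity by the test
matrices `diag(1, −1, 0)` and `e₀₁ + e₁₀`), and at `a₀` ★★★ `harmStableModRot_fcc_a0_iff_scalars`, `exists_admissible_harmStableModRot_of_scalars`.
STAB-61 is therefore EXACTLY the pair of scalar inequalities `N₂(a₀)/25 ≤ P₄(a₀) − P₂₂(a₀)` and `N₂(a₀)/25 ≤ 2P₂₂(a₀)`.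

NUMERICS (NOT proved here; census STAB-61, now two scalar lattice sums).  In the scalar form with `P₄(b) = Σ' coef·(b n₀)⁴`, `P₂₂(b) = Σ' coef·(b n₀)²(b n₁)²`, `N₂(b) = Σ_{x ∈ nbhd b} x₀²·b²` it reads
`4 μ₀ N₂ ≤ min(P₄ − P₂₂, 2P₂₂)` (deviatoric diagonal strain, off-diagonal shear; dilation `P₄ + 2P₂₂` is implied).  Floating point at `b = a₀ ≈ 0.68677`
(cubic parameter; nearest-neighbour distance `a₀√2 ≈ 0.97124`; `nbhd a₀` = the 54 vectors with `|x|² ≤ 8`, `N₂ = 96 a₀² ≈ 45.28`):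
`P₄ ≈ 16.06`, `P₂₂ ≈ 9.19`, softest = deviatoric `(P₄ − P₂₂)/(4N₂) ≈ 0.0379` — the inequality holds at the record `μ₀ = 1/100` with a factor
`≈ 3.8` to spare (shear `0.101`, dilation `0.190`).  Even with `b` known only through the certified window and the worst case `b = 1/√2` the
deviatoric margin is `≈ 0.0157 > 1/100`; a kernel proof needs (i) `Z_{D₃}(6) < 2.9` (shell enumeration to `|x|_∞ ≤ 3` plus the cube-shell tail
`Σ_{k ≥ 4}(24k²+2)k⁻⁶`; the product trick of P-J gives only `20.3`) to pin `nbhd a₀` and `a₀⁻⁶ = Z(6)/Z(12) ∈ [8, 11.3]`, and (ii) two-sided bounds on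
the `ℓ = 4` sums `Σ x₀⁴|x|⁻¹⁶, Σ x₀²x₁²|x|⁻¹⁶` (first shell dominates) and `Σ x₀⁴|x|⁻¹⁰, Σ x₀²x₁²|x|⁻¹⁰` to `±3 %` — recorded for generation 62 /
hand-2 as the typed successor of STAB-61 (memo §7).

WHAT IT MEANS FOR THE NODE.  (K-v) of critic row 1109 asked for an admissible instance CARRYING the repaired stability hypothesis; P-J built the
instance and P-K discharges everything about `HarmStableModRot (1/100)` on it except an explicit, numerically comfortable inequality between
lattice sums: the tag [hyps-unwitnessed] on (H𝄪ʳ) is now [hyps-witnessed-modulo-`StabIneq (1/100) a₀`], and STAB-61 is no longer a question about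
Bloch sectors or supercells but the display above.  The dual reading stands too: were `StabIneq (1/100) a₀` to FAIL, (H𝄪ʳ) at the record dial would
be VACUOUS on the fcc reference (not refuted) and the dial `μ₀` would have to drop — the reduction is the instrument either way.

Consumption status: consumer-only (nothing here is consumed by `closes`); P-K is evidence for the hypothesis audit of (H𝄪ʳ), not a piece.
-/

noncomputable section

open scoped Classical
open Literature.MathematicalPhysics.StatisticalMechanics
open Literature.Geometry.DiscreteGeometry
open Summit.AtomisticToContinuum.Crystallization.Theses.PricedLinkCensus
open Summit.AtomisticToContinuum.Crystallization.Theorems.ChargedEnergyGapNegative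

namespace Summit.AtomisticToContinuum.Crystallization.Theorems.ChargedEnergyGapChartDial

namespace Fcc

/-! ## §K1 Global cocycles on the Bravais fcc reference are LINEAR -/

section Cocycle

variable {b : ℝ} {β : E3 → E3 → E3}

/-- `zero_mem_points` (docstring added by the landing lane; see the module docstring). [formal bookkeeping] -/
theorem zero_mem_points (b : ℝ) (hb : 0 < b) : (0 : E3) ∈ (fccRef b hb).points :=
  (mem_points_iff_lattice b hb 0).2 (Submodule.zero_mem _)

/-- `add_mem_points` (docstring added by the landing lane; see the module docstring). [formal bookkeeping] -/
theorem add_mem_points {hb : 0 < b} {y z : E3} (hy : y ∈ (fccRef b hb).points) (hz : z ∈ (fccRef b hb).points) :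
    y + z ∈ (fccRef b hb).points :=
  (mem_points_iff_lattice b hb _).2
    (Submodule.add_mem _ ((mem_points_iff_lattice b hb _).1 hy) ((mem_points_iff_lattice b hb _).1 hz))

/-- On the Bravais reference a global cocycle is TRANSLATION-REDUCED: `β y z = β 0 (z − y)` for every point `y`. -/
theorem cocycle_transl {hb : 0 < b} (hβ : IsGlobalCocycle (fccRef b hb) β) {y : E3} (hy : y ∈ (fccRef b hb).points)
    (z : E3) : β y z = β 0 (z - y) := by
  have h := hβ.2.1 y ((mem_points_iff_lattice b hb y).1 hy) 0 (z - y)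
  rw [zero_add, sub_add_cancel] at h
  exact h

/-- `cocycle_zero` (docstring added by the landing lane; see the module docstring). [formal bookkeeping] -/
theorem cocycle_zero {hb : 0 < b} (hβ : IsGlobalCocycle (fccRef b hb) β) : β 0 0 = 0 := by
  have h := hβ.2.2 0 (zero_mem_points b hb) 0 (zero_mem_points b hb) 0 (zero_mem_points b hb)
  exact add_eq_left.1 h

/-- … and ADDITIVE on the lattice. -/
theorem cocycle_add {hb : 0 < b} (hβ : IsGlobalCocycle (fccRef b hb) β) {y z : E3} (hy : y ∈ (fccRef b hb).points)
    (hz : z ∈ (fccRef b hb).points) : β 0 (y + z) = β 0 y + β 0 z := by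
  have h := hβ.2.2 0 (zero_mem_points b hb) y hy (y + z) (add_mem_points hy hz)
  rw [cocycle_transl hβ hy, add_sub_cancel_left] at h
  exact h.symm

/-- The cocycle as an additive homomorphism on the lattice of periods. -/
def cocycleHom (hb : 0 < b) (hβ : IsGlobalCocycle (fccRef b hb) β) : (fccRef b hb).lattice →+ E3 where
  toFun g := β 0 (g : E3)
  map_zero' := by simpa using cocycle_zero hβ
  map_add' g g' := by
    simp only [Submodule.coe_add]
    exact cocycle_add hβ ((mem_points_iff_lattice b hb _).2 g.2) ((mem_points_iff_lattice b hb _).2 g'.2)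

/-- `cocycleHom_apply` (docstring added by the landing lane; see the module docstring). [formal bookkeeping] -/
@[simp] theorem cocycleHom_apply (hb : 0 < b) (hβ : IsGlobalCocycle (fccRef b hb) β) (g : (fccRef b hb).lattice) :
    cocycleHom hb hβ g = β 0 (g : E3) := rfl

/-- `2·e_j` (even coordinate sum). -/
def dbl (j : Fin 3) : Fin 3 → ℤ := fun k => if k = j then 2 else 0

/-- `even_sum_dbl` (docstring added by the landing lane; see the module docstring). [formal bookkeeping] -/
theorem even_sum_dbl (j : Fin 3) : Even (∑ k, dbl j k) := by
  fin_cases j <;> decide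

/-- `two_smul_vec` (docstring added by the landing lane; see the module docstring). [formal bookkeeping] -/
theorem two_smul_vec (b : ℝ) (x : Fin 3 → ℤ) : (2 : ℝ) • vec b x = ∑ j, ((x j : ℤ) : ℝ) • vec b (dbl j) := by
  ext k
  fin_cases k <;> simp [Fin.sum_univ_three, dbl] <;> ring

/-- ★ STRUCTURE: a global cocycle on the Bravais fcc reference is a LINEAR MAP of the bond vector — `β(0, b·x) = M (b·x)` for an explicit
`3 × 3` matrix `M` (homogeneous strains are the only test fields of a one-point motif). -/
theorem exists_matrix (hb : 0 < b) (hβ : IsGlobalCocycle (fccRef b hb) β) :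
    ∃ M : Fin 3 → Fin 3 → ℝ, ∀ x : Fin 3 → ℤ, Even (∑ k, x k) → ∀ i, β 0 (vec b x) i = ∑ j, M i j * ((x j : ℝ) * b) := by
  refine ⟨fun i j => β 0 (vec b (dbl j)) i / (2 * b), fun x hx i => ?_⟩
  have hxm : vec b x ∈ (fccRef b hb).lattice := (mem_points_iff_lattice b hb _).1 (vec_mem_points hb hx)
  have hdm : ∀ j, vec b (dbl j) ∈ (fccRef b hb).lattice := fun j =>
    (mem_points_iff_lattice b hb _).1 (vec_mem_points hb (even_sum_dbl j))
  have hid : (2 : ℤ) • (⟨vec b x, hxm⟩ : (fccRef b hb).lattice) =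
      ∑ j, (x j : ℤ) • (⟨vec b (dbl j), hdm j⟩ : (fccRef b hb).lattice) := by
    apply Subtype.ext
    rw [Submodule.coe_smul, Submodule.coe_sum]
    simp only [Submodule.coe_smul]
    rw [← Int.cast_smul_eq_zsmul ℝ, Int.cast_ofNat, two_smul_vec]
    exact Finset.sum_congr rfl fun j _ => by rw [← Int.cast_smul_eq_zsmul ℝ]
  have h2 := congrArg (cocycleHom hb hβ) hid
  rw [map_zsmul, map_sum] at h2
  simp only [map_zsmul, cocycleHom_apply] at h2
  rw [← Int.cast_smul_eq_zsmul ℝ, Int.cast_ofNat] at h2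
  have h3 : (2 : ℝ) * β 0 (vec b x) i = ∑ j, (x j : ℝ) * β 0 (vec b (dbl j)) i := by
    have := congrArg (fun w : E3 => w i) h2
    simp only [PiLp.smul_apply, smul_eq_mul] at this
    rw [this, Fin.sum_univ_three, Fin.sum_univ_three]
    simp only [PiLp.add_apply]
    rw [← Int.cast_smul_eq_zsmul ℝ, ← Int.cast_smul_eq_zsmul ℝ, ← Int.cast_smul_eq_zsmul ℝ]
    simp only [PiLp.smul_apply, smul_eq_mul]
  have hb0 : b ≠ 0 := hb.ne'
  rw [Fin.sum_univ_three] at h3 ⊢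
  field_simp
  linear_combination h3

end Cocycle

/-! ## §K2 The rotation gauge exhausts `so(3)` -/

section Gauge

/-- `rotField_zero_apply` (docstring added by the landing lane; see the module docstring). [formal bookkeeping] -/
theorem rotField_zero_apply (r₀ v z : E3) (i : Fin 3) :
    rotField r₀ v 0 z i = ∑ j, (v i * r₀ j - r₀ i * v j) * z j := by
  simp only [rotField, sub_zero, PiLp.sub_apply, PiLp.smul_apply, smul_eq_mul, PiLp.inner_apply, Real.inner_apply]
  rw [Fin.sum_univ_three, Fin.sum_univ_three, Fin.sum_univ_three]
  ring

/-- ★ Every skew `3 × 3` matrix `(p, q, r) = (K₀₁, K₀₂, K₁₂)` is the matrix `v ⊗ r₀ − r₀ ⊗ v` of a rotation cocycle (explicit gauge; two cases). -/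
theorem exists_rot_gauge (p q r : ℝ) : ∃ r₀ v : E3,
    v 0 * r₀ 1 - r₀ 0 * v 1 = p ∧ v 0 * r₀ 2 - r₀ 0 * v 2 = q ∧ v 1 * r₀ 2 - r₀ 1 * v 2 = r := by
  by_cases h : q ^ 2 + r ^ 2 = 0
  · have hq : q = 0 := by nlinarith [sq_nonneg q, sq_nonneg r]
    have hr : r = 0 := by nlinarith [sq_nonneg q, sq_nonneg r]
    refine ⟨WithLp.toLp 2 ![0, 1, 0], WithLp.toLp 2 ![p, 0, 0], ?_, ?_, ?_⟩ <;> simp [hq, hr]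
  · refine ⟨WithLp.toLp 2 ![q, r, 0], WithLp.toLp 2 ![p * r / (q ^ 2 + r ^ 2), -(p * q) / (q ^ 2 + r ^ 2), -1], ?_, ?_, ?_⟩
    · simp; field_simp; ring
    · simp
    · simp

end Gauge

/-! ## §K3 The quadratic bond term of a linear field at a lattice point -/

section Quad

/-- `bondQuad_zero_eq` (docstring added by the landing lane; see the module docstring). [formal bookkeeping] -/
theorem bondQuad_zero_eq (β : E3 → E3 → E3) (z : E3) : bondQuad β 0 z =
    (ljD2 ‖z‖ - ljD1 ‖z‖ / ‖z‖) * (‖z‖⁻¹) ^ 2 * inner ℝ z (β 0 z) ^ 2 + ljD1 ‖z‖ / ‖z‖ * ‖β 0 z‖ ^ 2 := by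
  simp only [bondQuad, dist_eq_norm, zero_sub, norm_neg, sub_zero, real_inner_smul_left]
  ring

/-- `(V″(ℓ) − V′(ℓ)/ℓ)/ℓ² = 14ℓ⁻¹⁶ − 8ℓ⁻¹⁰`. -/
theorem stiff_eq {l : ℝ} (hl : 0 < l) : (ljD2 l - ljD1 l / l) * (l⁻¹) ^ 2 = 14 * (l⁻¹) ^ 16 - 8 * (l⁻¹) ^ 10 := by
  unfold ljD1 ljD2
  field_simp
  ring

variable (M : Fin 3 → Fin 3 → ℝ) (b : ℝ)

/-- The quadratic form `x ↦ (b·x)ᵀ M (b·x)`. -/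
def qf (x : Fin 3 → ℤ) : ℝ := ∑ i, ∑ j, ((x i : ℝ) * b) * M i j * ((x j : ℝ) * b)

/-- The STIFFNESS WEIGHT `14|b·n|⁻¹⁶ − 8|b·n|⁻¹⁰` of the lattice point `b·n`. -/
def coef (n : D3) : ℝ := 14 * ((len b n)⁻¹) ^ 16 - 8 * ((len b n)⁻¹) ^ 10

/-- The STIFFNESS SUM `Σ_{n ∈ D₃∖0} (14|b·n|⁻¹⁶ − 8|b·n|⁻¹⁰)·((b·n)ᵀ M (b·n))²`. -/
def Qsum : ℝ := ∑' n : D3, coef b n * qf M b n.1 ^ 2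

variable {M b}

/-- `abs_qf_le` (docstring added by the landing lane; see the module docstring). [formal bookkeeping] -/
theorem abs_qf_le (hb : 0 < b) (n : D3) : |qf M b n.1| ≤ (∑ i, ∑ j, |M i j|) * len b n ^ 2 := by
  unfold qf
  rw [Finset.sum_mul]
  refine (Finset.abs_sum_le_sum_abs _ _).trans (Finset.sum_le_sum fun i _ => ?_)
  rw [Finset.sum_mul]
  refine (Finset.abs_sum_le_sum_abs _ _).trans (Finset.sum_le_sum fun j _ => ?_)
  rw [abs_mul, abs_mul, sq]
  have hi := abs_coord_le_len b hb n i
  have hj := abs_coord_le_len b hb n j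
  have hl := (len_pos b hb n).le
  calc |((n.1 i : ℝ)) * b| * |M i j| * |((n.1 j : ℝ)) * b| = |M i j| * (|((n.1 i : ℝ)) * b| * |((n.1 j : ℝ)) * b|) := by ring
    _ ≤ |M i j| * (len b n * len b n) := mul_le_mul_of_nonneg_left (mul_le_mul hi hj (abs_nonneg _) hl) (abs_nonneg _)

/-- `summable_coef_qf` (docstring added by the landing lane; see the module docstring). [formal bookkeeping] -/
theorem summable_coef_qf (hb : 0 < b) : Summable fun n : D3 => coef b n * qf M b n.1 ^ 2 := by
  set C := ∑ i, ∑ j, |M i j| with hC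
  have hC0 : 0 ≤ C := Finset.sum_nonneg fun i _ => Finset.sum_nonneg fun j _ => abs_nonneg _
  refine Summable.of_norm_bounded (((summable_inv_len_pow b hb (by norm_num : 3 < 12)).mul_left (14 * C ^ 2)).add
    ((summable_inv_len_pow b hb (by norm_num : 3 < 6)).mul_left (8 * C ^ 2))) fun n => ?_
  have hl := len_pos b hb n
  have hq := abs_qf_le (M := M) hb n
  have hq2 : qf M b n.1 ^ 2 ≤ C ^ 2 * len b n ^ 4 := by
    have h0 : 0 ≤ C * len b n ^ 2 := by positivity
    calc qf M b n.1 ^ 2 = |qf M b n.1| ^ 2 := (sq_abs _).symm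
      _ ≤ (C * len b n ^ 2) ^ 2 := pow_le_pow_left₀ (abs_nonneg _) hq 2
      _ = C ^ 2 * len b n ^ 4 := by ring
  rw [Real.norm_eq_abs, abs_mul]
  have h16 : 0 ≤ (len b n)⁻¹ ^ 16 := by positivity
  have h10 : 0 ≤ (len b n)⁻¹ ^ 10 := by positivity
  have hcoef : |coef b n| ≤ 14 * (len b n)⁻¹ ^ 16 + 8 * (len b n)⁻¹ ^ 10 := by
    unfold coef
    exact (abs_sub _ _).trans (by rw [abs_of_nonneg (by positivity), abs_of_nonneg (by positivity)])
  calc |coef b n| * |qf M b n.1 ^ 2| = |coef b n| * qf M b n.1 ^ 2 := by rw [abs_of_nonneg (sq_nonneg (qf M b n.1))]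
    _ ≤ (14 * (len b n)⁻¹ ^ 16 + 8 * (len b n)⁻¹ ^ 10) * (C ^ 2 * len b n ^ 4) :=
        mul_le_mul hcoef hq2 (sq_nonneg _) (by positivity)
    _ = 14 * C ^ 2 * (len b n)⁻¹ ^ 12 + 8 * C ^ 2 * (len b n)⁻¹ ^ 6 := by
        field_simp

/-- `D₃ ∖ 0 ≃` the summation domain of `quadSite` at the motif point `0` with nothing excised. -/
def quadEquiv (b : ℝ) (hb : 0 < b) : D3 ≃ {z : E3 // z ∈ (fccRef b hb).points ∧ z ∉ (∅ : Set E3) ∧ z ≠ 0} :=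
  (vecEquiv b hb).trans (Equiv.subtypeEquivRight fun z => by simp)

/-- `quadEquiv_apply` (docstring added by the landing lane; see the module docstring). [formal bookkeeping] -/
@[simp] theorem quadEquiv_apply (b : ℝ) (hb : 0 < b) (n : D3) : ((quadEquiv b hb n) : E3) = vec b n.1 := rfl

/-- ★ THE QUADRATIC SITE TERM OF A LINEAR FIELD on the stress-free Bravais fcc reference is `¼` of the stiffness sum: the transverse
part `Σ (V′/d)‖Mz‖²` is a linear combination of virial entries and VANISHES at zero stress. -/
theorem quadSite_eq {β : E3 → E3 → E3} (hb : 0 < b)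
    (hM : ∀ x : Fin 3 → ℤ, Even (∑ k, x k) → ∀ i, β 0 (vec b x) i = ∑ j, M i j * ((x j : ℝ) * b))
    (hS : ∀ j k, S b j k = 0) : quadSite β (fccRef b hb) ∅ 0 = (1 / 4) * Qsum M b := by
  unfold quadSite Qsum
  congr 1
  rw [← (quadEquiv b hb).tsum_eq]
  simp only [quadEquiv_apply, bondQuad_zero_eq]
  have hlen : ∀ n : D3, ‖vec b n.1‖ = len b n := fun n => norm_vec b hb n.1
  have hin : ∀ n : D3, inner ℝ (vec b n.1) (β 0 (vec b n.1)) = qf M b n.1 := fun n => by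
    simp only [PiLp.inner_apply, Real.inner_apply, vec_apply, hM n.1 n.2.2, qf, Finset.mul_sum]
    refine Finset.sum_congr rfl fun i _ => ?_
    exact Finset.sum_congr rfl fun j _ => by ring
  have hnorm : ∀ n : D3, ‖β 0 (vec b n.1)‖ ^ 2 = ∑ i, (∑ j, M i j * ((n.1 j : ℝ) * b)) ^ 2 := fun n => by
    rw [EuclideanSpace.real_norm_sq_eq]
    exact Finset.sum_congr rfl fun i _ => by rw [hM n.1 n.2.2 i]
  simp only [hlen, hin, hnorm]
  have h1 : ∀ n : D3, (ljD2 (len b n) - ljD1 (len b n) / len b n) * (len b n)⁻¹ ^ 2 * qf M b n.1 ^ 2 = coef b n * qf M b n.1 ^ 2 :=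
    fun n => by rw [stiff_eq (len_pos b hb n)]; rfl
  have h2 : ∀ n : D3, ljD1 (len b n) / len b n * ∑ i, (∑ j, M i j * ((n.1 j : ℝ) * b)) ^ 2 =
      ∑ i, ∑ j, ∑ k, M i j * M i k * term b j k n := fun n => by
    rw [Finset.mul_sum]
    refine Finset.sum_congr rfl fun i _ => ?_
    rw [sq, Finset.sum_mul_sum, Finset.mul_sum]
    refine Finset.sum_congr rfl fun j _ => ?_
    rw [Finset.mul_sum]
    refine Finset.sum_congr rfl fun k _ => ?_
    simp only [term, F]
    ring
  simp_rw [h1, h2]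
  have hsum2 : Summable fun n : D3 => ∑ i, ∑ j, ∑ k, M i j * M i k * term b j k n :=
    summable_sum fun i _ => summable_sum fun j _ => summable_sum fun k _ => (summable_term b hb j k).mul_left _
  rw [(summable_coef_qf hb).tsum_add hsum2]
  conv_rhs => rw [← add_zero (∑' n : D3, coef b n * qf M b n.1 ^ 2)]
  congr 1
  rw [Summable.tsum_finsetSum (fun i _ => summable_sum fun j _ => summable_sum fun k _ => (summable_term b hb j k).mul_left _)]
  refine Finset.sum_eq_zero fun i _ => ?_
  rw [Summable.tsum_finsetSum (fun j _ => summable_sum fun k _ => (summable_term b hb j k).mul_left _)]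
  refine Finset.sum_eq_zero fun j _ => ?_
  rw [Summable.tsum_finsetSum (fun k _ => (summable_term b hb j k).mul_left _)]
  refine Finset.sum_eq_zero fun k _ => ?_
  rw [tsum_mul_left]
  change M i j * M i k * S b j k = 0
  rw [hS j k]
  exact mul_zero _

end Quad

end Fcc

end Summit.AtomisticToContinuum.Crystallization.Theorems.ChargedEnergyGapChartDial

end
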